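import Summits.BirchSwinnertonDyer.BirchSwinnertonDyer.Theorems.SignedBaseChangeAnticyclotomicEisensteinDivisibilityEisensteinTransfer
import Summits.BirchSwinnertonDyer.BirchSwinnertonDyer.Theorems.SignedBaseChangeAnticyclotomicEisensteinDivisibilityFrameConcordance
import Summits.BirchSwinnertonDyer.BirchSwinnertonDyer.Theses.SignedBaseChange
import Summits.BirchSwinnertonDyer.BirchSwinnertonDyer.Theorems.SignedBaseChangeAnticyclotomicEisensteinDivisibilityTransferSideInjective
import Summits.BirchSwinnertonDyer.BirchSwinnertonDyer.Theorems.SignedBaseChangeAnticyclotomicEisensteinDivisibilityXAcTorsionSignedCarrier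
import Summits.BirchSwinnertonDyer.BirchSwinnertonDyer.Theorems.SignedBaseChangeAnticyclotomicEisensteinDivisibilityXAcTorsionSignedRank
import Summits.BirchSwinnertonDyer.BirchSwinnertonDyer.Theorems.SignedBaseChangeAnticyclotomicEisensteinDivisibilityAnticyclotomicNonsplit
import Summits.BirchSwinnertonDyer.BirchSwinnertonDyer.Theorems.UniversalToricDescentSignedSettingNoPTorsion
import Summits.BirchSwinnertonDyer.BirchSwinnertonDyer.Theorems.UniversalToricDescentTwinFullThreeAdicImageOverK
import Summits.BirchSwinnertonDyer.BirchSwinnertonDyer.Theorems.EisensteinPrimesTwistDeformationFullAtSelmerOfFacts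
import Literature.NumberTheory.EllipticCurves.AnticyclotomicSignedSelmerRelaxedEquality
import Literature.NumberTheory.EllipticCurves.BSDSelmerPConverseSerreProofs
import Literature.NumberTheory.EllipticCurves.ZywinaCMImageProofs
import Literature.NumberTheory.EllipticCurves.HeightConductorBoundsModularityProofs
import Literature.NumberTheory.EllipticCurves.YanZhu2026.GreenbergMainTheoremsAnyRoot
import Summits.BirchSwinnertonDyer.Rank1Residual.X11b.HalvesReceptacle
import Summits.BirchSwinnertonDyer.Rank1Residual.X11b.BDPRouteOpenInputDescent
import Literature.NumberTheory.EllipticCurves.PAdicGrossZagierConstantTermProofs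
import Literature.NumberTheory.EllipticCurves.NonEisensteinPrimeOfSurjective
import HarnessLib

/-!
# Stub S1 `stub_bdpLowerHalfRatSS` of line `bdpline` (crux `AnticyclotomicEisensteinDivisibility`,
# stmt-BirchSwinnertonDyer-20727) — helper C: **S1 on the sub-cell `p ∤ h_K` REDUCES to the Eisenstein
# direction of the signed Heegner point main conjecture** (rational, sign `+`, Castella–Wan currency)
# modulo four REFEREED printed facts

Width seat bsd-line-sbc-p1-w2 (gen 5), `--supports stmt-BirchSwinnertonDyer-20727`. The registered
research stub S1 = `Bdpline.stub_bdpLowerHalfRatSS` (the RATIONAL Eisenstein half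
`p^k · ch_Λ(X_ac) · 𝒪_{ℂ_p}⟦T⟧ ⊆ (L_p^BDP)` in EVERY BDP frame, at a good supersingular `p ≥ 5`, `Surj`,
Heegner `K`, any `N`) has no print at additive `N` (LEAD census v3: promote-stub; planner to split). THIS
FILE proves: the registered S1 text with ONE extra binder `¬ p ∣ NumberField.classNumber K` (inserted after
`IsImaginaryQuadratic K →`, the binder order of v22's `stub_xAcTorsionSS_coprime`) FOLLOWS from

* (RESEARCH, Heegner-point currency) `hKoly` — for Castella–Wan's signed Heegner class `z⁺` and BDP frame
  `L` (any pair carrying the six typed inputs `AcSigned.TransferInputs` and Prop. 2.1's frame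
  `IsCWBDPLFunction`), `p^k · char_Λ(X_{+,tors}) ⊆ ι(char_Λ(Sel_+(K, 𝐓^ac)/Λ z⁺))²` for some `k`: the
  `ι`-twisted, rational form of the `⊆` direction of Castella–Wan's Conj. 4.8 (3) — Bertolini–Longo–Venerucci
  Math. Ann. 2026 Thm. A proves the EQUALITY on the all-additive sub-cell under their Hyp. 1.1; C.-H. Kim's
  height-one-prime criterion + Kolyvagin non-vanishing is the other road;
* (PRINT, refereed) Longo–Vigni 2019 Thm. 1.4 (`AcSigned.longoVigni2019_thm14_signedSelmerDual_rank_one`),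
  Castella–Wan 2024 proof of Thm. 6.8 inputs (`AcSigned.castellaWan2024_proofThm68_transferInputs`), Lemma 6.7
  (`AcSigned.castellaWan2024_lemma67_finrank_torsionCharIdeal`) and the sentence "`Sel_±(K, 𝐓^ac) =
  Sel_{±,rel}(K, 𝐓^ac)`" of the proof of Thm. 6.8 (MS p. 30) — the latter typed as the named fact `AcSigned.castellaWan2024_proofThm68_selmerRel_le_selmerSgn`
  (`Literature/…/AnticyclotomicSignedSelmerRelaxedEquality.lean`, p636148),

through helper A (`SignedBaseChangeAcDivEisensteinTransfer`, p634573: the Eisenstein-direction transfer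
(i) ⟹ (ii) of Thm. 6.8), helper B (`SignedBaseChangeAcDivFrameConcordance`, p634869: Castella–Wan's frame and
Castella's frame generate the same ideal of `𝒪_{ℂ_p}⟦T⟧`) and the width seat w4's Kobayashi-carrier road
(`Setting`, `IsNonsplitIn` from `p ∤ h_K`, the rank of `X_+` from Longo–Vigni). Proposed reshape for the
LEAD: S1 ↦ S1_coprime (DERIVED from a registered stub with the text of `hKoly` + the four facts) and
S1_classDvd (research, as is). Nothing here proves BSD or the crux; the research input is a HYPOTHESIS.
-/

-- D-0017: single-problem summit, the namespace repeats the problem name by design.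
set_option linter.dupNamespace false
set_option autoImplicit false

noncomputable section

open scoped Classical

open PowerSeries NumberField IsDedekindDomain Field CongruenceSubgroup
open Literature.NumberTheory.EllipticCurves Literature.NumberTheory.GaloisRepresentations
  Literature.NumberTheory.EllipticCurves.ModularForms Literature.NumberTheory.EllipticCurves.Rank1Residual
  Literature.NumberTheory.EllipticCurves.YanZhu2026 Literature.NumberTheory.EllipticCurves.AcSigned
  Literature.NumberTheory.EllipticCurves.Kobayashi2003 Literature.NumberTheory.EllipticCurves.IwasawaDual
open Summit.BirchSwinnertonDyer.BirchSwinnertonDyer.Theses.SignedBaseChange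
open Summit.BirchSwinnertonDyer.BirchSwinnertonDyer.Theorems
open Summit.BirchSwinnertonDyer.Rank1Residual.X11b

universe u

namespace Summit.BirchSwinnertonDyer.BirchSwinnertonDyer.Theorems.SignedBaseChangeAcDivS1OfSignedEisenstein

/-! ## The assembly: S1 on `p ∤ h_K` from the signed Eisenstein direction and four printed facts -/

/-- **S1 (registered text of `Bdpline.stub_bdpLowerHalfRatSS` + ONE binder `¬ p ∣ h_K`) from the rational
Eisenstein direction of the signed Heegner point main conjecture (sign `+`, Castella–Wan currency) and four
refereed typed facts.** Assembly: `Setting` from the crux binders and `p ∤ h_K`; `IsNonsplitIn κ₂ v` + local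
generator (`p ∤ h_K`); Castella–Wan's frame `(Ω_K, Ω_p, L_W)` with `IsCWBDPLFunction` and the class `z⁺` with
`TransferInputs` (fact); `rank X_+ = 1` (Longo–Vigni on Kobayashi's dual, transported by the identity of the
two signed Selmer groups); `finrank Sel_+ = 1` (Lemma 6.7 (1)); `loc_v` injective on `Sel_+` (w3's `…TransferSideInjective`, p-landed); `hEq` (the
MS p. 30 sentence); the Eisenstein input at `(z⁺, L_W)` (hypothesis); helper A ⟹
`p^k·Ch_Λ(X_ac)·R₀⟦T⟧ ⊆ (L_W)` along `ℤ_p → R₀`; push-forward along `J₀ : R₀ → 𝒪_{ℂ_p}` (`J = J₀ ∘ toUnr`);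
helper B ⟹ `(J₀ L_W) = (J₀ L)` for the BDP frame `L` handed in (`p ∤ N` from good reduction, `p ∤ D_K` from
`p` split). [cite: CastellaWan2023, Thm. 6.8 and its proof (MS pp. 29–31), Prop. 2.1 (MS p. 6), Lemma 6.7 (MS p. 28)]
[cite: LongoVigni2019, Thm. 1.4] [cite: Castella2018, Def. 2.2 and Thm. 3.1 (arXiv:1704.06608 pp. 5, 9)] -/
theorem bdpLowerHalfRatSS_coprime_of_signedEisenstein
    (hKoly : SignedTwoVariableInputs → Literature.NumberTheory.EllipticCurves.ModularForms.nonempty_modularParametrizationData → ∀ (W : WeierstrassCurve ℚ) [W.IsElliptic] [W.IsGloballyMinimal] (p : ℕ) [Fact p.Prime], 5 ≤ p → W.HasGoodReductionAtPrime p → W.frobeniusTrace p = 0 → Literature.NumberTheory.EllipticCurves.Rank1Residual.Surj W p → ∀ (K : Type) [Field K] [NumberField K] (ι : PadicAlgCl p ≃+* ℂ) (v vbar : IsDedekindDomain.HeightOneSpectrum (NumberField.RingOfIntegers K)) (κ₁ κ₂ : Literature.NumberTheory.EllipticCurves.ZpExtension K p) (γ₁ γ₂ : Field.absoluteGaloisGroup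 K) [Fact (Literature.NumberTheory.EllipticCurves.ZpExtension.IsTopGeneratorPair κ₁ κ₂ γ₁ γ₂)] [NeZero (NumberField.discr K).natAbs] (N : ℕ) [NeZero N] (f : CuspForm (CongruenceSubgroup.Gamma0 N) 2), Literature.NumberTheory.EllipticCurves.ModularForms.IsNewformOf W f → (N : ℤ) = W.conductorNorm ℤ → Literature.NumberTheory.EllipticCurves.IsImaginaryQuadratic K → ¬ p ∣ NumberField.classNumber K → ((Ideal.span {(p : ℤ)}).primesOver (NumberField.RingOfIntegers K)).ncard = 2 → ((p : ℕ) : NumberField.RingOfIntegers K) ∈ v.asIdeal → ((p : ℕ) : NumberField.RingOfIntegers K) ∈ vbar.asIdeal → vbar ≠ v → (∀ (w : NumberField.InfinitePlace K) (k : NumberField.RingOfIntegers K), k ∈ v.asIdeal ↔ ‖ι.symm (w.embedding (k : K))‖ < 1) → IsCoprime (N : ℤ) (NumberField.discr K) → (∀ ℓ : ℕ, ℓ.Prime → ℓ ∣ N → ((Ideal.span {(ℓ : ℤ)}).primesOver (NumberField.RingOfIntegers K)).ncard = 2) → Odd (NumberField.discr K) → NumberField.discr K ≠ -3 → κ₁.IsCyclotomic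 → κ₂.IsAnticyclotomic → ∀ (h𝔭 : AcSigned.IsNonsplitIn κ₂ v) (γ𝔭 : Field.absoluteGaloisGroup (v.adicCompletion K)) (hγ𝔭 : κ₂ (resGalOfEmb (closureEmb (K := K) (v.adicCompletion K)) γ𝔭) = κ₂ γ₂) (hne : v ≠ vbar) (hvp : ((p : ℕ) : NumberField.RingOfIntegers K) ∈ v.asIdeal) (ΩK : ℂ) (Ωp : (unrIntegers p)ˣ) (L : UnrSeries p) (z : AcSigned.selmerLambdaAdic (W.baseChange K) p κ₂ γ₂ (fun _ ↦ .sgn 1)), ΩK ≠ 0 → CastellaWan2024.IsCWBDPLFunction ι v κ₂ γ₂ f (NumberField.discr K) ΩK ((Ωp : unrIntegers p) : PadicComplex p) L → AcSigned.TransferInputs (W.baseChange K) p κ₂ γ₂ (YanZhu2026.isTopGenerator_of_pair (κ₁ := κ₁) (γ₁ := γ₁) : κ₂.IsTopGenerator γ₂) v h𝔭 γ𝔭 hγ𝔭 vbar hne hvp 1 z L → ∃ k : ℕ, Ideal.span {((p : ℕ) : IwasawaAlgebra p) ^ k} * AcSigned.X.torsionCharIdeal (W.baseChange K) p κ₂ ∅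 (fun _ ↦ .sgn 1) (YanZhu2026.isTopGenerator_of_pair (κ₁ := κ₁) (γ₁ := γ₁) : κ₂.IsTopGenerator γ₂) ≤ (AcSigned.signedHeegnerCharIdeal (YanZhu2026.isTopGenerator_of_pair (κ₁ := κ₁) (γ₁ := γ₁) : κ₂.IsTopGenerator γ₂) 1 z).map (IwasawaAlgebra.invol p) ^ 2)
    (hLV : ∀ (W : WeierstrassCurve ℚ) [W.IsGloballyMinimal] (K : Type) [Field K] [NumberField K]
      (p : ℕ) [Fact p.Prime] (κ : ZpExtension K p) (𝔭 𝔭' : HeightOneSpectrum (𝓞 K)),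
      longoVigni2019_thm14_signedSelmerDual_rank_one W K p κ 𝔭 𝔭')
    (hCW : ∀ (N : ℕ) [NeZero N] (W : WeierstrassCurve ℚ) [W.IsGloballyMinimal] (K : Type) [Field K]
      [NumberField K] (p : ℕ) [Fact p.Prime] (κ : ZpExtension K p) (𝔭 𝔭' : HeightOneSpectrum (𝓞 K)),
      castellaWan2024_proofThm68_transferInputs N W K p κ 𝔭 𝔭')
    (hL67 : ∀ (N : ℕ) [NeZero N] (W : WeierstrassCurve ℚ) [W.IsGloballyMinimal] (K : Type) [Field K]
      [NumberField K] (p : ℕ) [Fact p.Prime] (κ : ZpExtension K p) (𝔭 𝔭' : HeightOneSpectrum (𝓞 K)),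
      castellaWan2024_lemma67_finrank_torsionCharIdeal N W K p κ 𝔭 𝔭')
    (hRel : ∀ (N : ℕ) [NeZero N] (W : WeierstrassCurve ℚ) [W.IsGloballyMinimal] (K : Type) [Field K]
      [NumberField K] (p : ℕ) [Fact p.Prime] (κ : ZpExtension K p) (𝔭 𝔭' : HeightOneSpectrum (𝓞 K)),
      castellaWan2024_proofThm68_selmerRel_le_selmerSgn N W K p κ 𝔭 𝔭') :
    SignedTwoVariableInputs → Literature.NumberTheory.EllipticCurves.ModularForms.nonempty_modularParametrizationData → ∀ (W : WeierstrassCurve ℚ) [W.IsElliptic] [W.IsGloballyMinimal] (p : ℕ) [Fact p.Prime], 5 ≤ p → W.HasGoodReductionAtPrime p → W.frobeniusTrace p = 0 → Literature.NumberTheory.EllipticCurves.Rank1Residual.Surj W p → ∀ (K : Type) [Field K] [NumberField K] (ι : PadicAlgCl p ≃+* ℂ) (v vbar : IsDedekindDomain.HeightOneSpectrum (NumberField.RingOfIntegers K)) (κ₁ κ₂ : Literature.NumberTheory.EllipticCurves.ZpExtension K p) (γ₁ γ₂ : Field.absoluteGaloisGroup K) [Fact (Literature.NumberTheory.EllipticCurves.ZpExtension.IsTopGeneratorPair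 κ₁ κ₂ γ₁ γ₂)] [NeZero (NumberField.discr K).natAbs] (N : ℕ) [NeZero N] (f : CuspForm (CongruenceSubgroup.Gamma0 N) 2), Literature.NumberTheory.EllipticCurves.ModularForms.IsNewformOf W f → (N : ℤ) = W.conductorNorm ℤ → Literature.NumberTheory.EllipticCurves.IsImaginaryQuadratic K → ¬ p ∣ NumberField.classNumber K → ((Ideal.span {(p : ℤ)}).primesOver (NumberField.RingOfIntegers K)).ncard = 2 → ((p : ℕ) : NumberField.RingOfIntegers K) ∈ v.asIdeal → ((p : ℕ) : NumberField.RingOfIntegers K) ∈ vbar.asIdeal → vbar ≠ v → (∀ (w : NumberField.InfinitePlace K) (k : NumberField.RingOfIntegers K), k ∈ v.asIdeal ↔ ‖ι.symm (w.embedding (k : K))‖ < 1) → IsCoprime (N : ℤ) (NumberField.discr K) → (∀ ℓ : ℕ, ℓ.Prime → ℓ ∣ N → ((Ideal.span {(ℓ : ℤ)}).primesOver (NumberField.RingOfIntegers K)).ncard = 2) → Odd (NumberField.discr K) → NumberField.discr K ≠ -3 → κ₁.IsCyclotomic → κ₂.IsAnticyclotomic → (haveI : Fact (κ₂.IsTopGenerator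 γ₂) := ⟨Literature.NumberTheory.EllipticCurves.YanZhu2026.isTopGenerator_of_pair (κ₁ := κ₁) (γ₁ := γ₁)⟩; Module.IsTorsion (Literature.NumberTheory.EllipticCurves.IwasawaAlgebra p) (Literature.NumberTheory.EllipticCurves.Castella2018.AcSelmer.XAc (W.baseChange K) p κ₂ vbar ∅ γ₂)) → ∀ (ΩK : ℂ) (Ωp' : (Literature.NumberTheory.EllipticCurves.unrIntegers p)ˣ) (L : Literature.NumberTheory.EllipticCurves.UnrSeries p), ΩK ≠ 0 → Literature.NumberTheory.EllipticCurves.IsBDPLFunction ι v κ₂ γ₂ f ΩK ((Ωp' : Literature.NumberTheory.EllipticCurves.unrIntegers p) : PadicComplex p) L → ∀ J : ℤ_[p] →+* PadicComplexInt p, (∀ x : ℤ_[p], ((J x : PadicComplexInt p) : PadicComplex p) = ((x : ℚ_[p]) : PadicComplex p)) → ∀ (J₀ : Literature.NumberTheory.EllipticCurves.unrIntegers p →+* PadicComplexInt p), (∀ x : Literature.NumberTheory.EllipticCurves.unrIntegers p, ((J₀ x : PadicComplexInt p) : PadicComplex p) = (x : PadicComplex p)) → ∃ k : ℕ, ∀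 y ∈ (haveI : Fact (κ₂.IsTopGenerator γ₂) := ⟨Literature.NumberTheory.EllipticCurves.YanZhu2026.isTopGenerator_of_pair (κ₁ := κ₁) (γ₁ := γ₁)⟩; Literature.NumberTheory.EllipticCurves.Castella2018.AcSelmer.XAc.charIdeal (W.baseChange K) p κ₂ vbar ∅ γ₂).map (PowerSeries.map J), PowerSeries.C (((p : ℕ) : PadicComplexInt p) ^ k) * y ∈ Ideal.span {PowerSeries.map J₀ L} := by
  intro hIn hmodP W _ _ p _ hp hgood ha0 hs K _ _ ι v vbar κ₁ κ₂ γ₁ γ₂ _ _ N _ f hf hN hK hh hsplit hv hvbar hvv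
    hι hcop hHeeg hodd hne3 hκ₁ hκ₂ _ ΩK Ωp' L hΩK hL J hJ J₀ hJ₀
  haveI hγF : Fact (κ₂.IsTopGenerator γ₂) := ⟨isTopGenerator_of_pair (κ₁ := κ₁) (γ₁ := γ₁)⟩
  have hprime : p.Prime := Fact.out
  have hp2 : p ≠ 2 := by omega
  have hp3 : 3 < p := by omega
  haveI : (W.baseChange K).IsElliptic := by rw [WeierstrassCurve.baseChange]; infer_instance
  -- the `Setting` of the anticyclotomic signed theory (with `p ∤ h_K`), in both orders
  have hS : AcSigned.Setting W K p κ₂ v vbar :=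
    ⟨inferInstance, hp2, ⟨hgood, by rw [ha0]; exact dvd_zero _⟩, ha0, hK, hv, hvbar, hvv, hκ₂, hh⟩
  have hS' : AcSigned.Setting W K p κ₂ vbar v :=
    ⟨inferInstance, hp2, ⟨hgood, by rw [ha0]; exact dvd_zero _⟩, ha0, hK, hvbar, hv, hvv.symm, hκ₂, hh⟩
  -- the conductor and the Heegner hypothesis in the facts' currency
  have h11 : 11 ≤ W.conductorNorm ℤ := eleven_le_conductorNorm_of_modularity hmodP W
  have hN' : (W.conductorNorm ℤ : ℕ) = N := by exact_mod_cast hN.symm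
  have h3N : 3 < N := by rw [← hN']; omega
  have hHg : SatisfiesHeegnerHypothesis N K := fun ℓ hℓ hℓN ↦ hHeeg ℓ hℓ hℓN
  -- no CM and the big `p`-adic image from `Surj` at `p ≥ 5`
  have hCM : ¬ W.HasCM := fun hCM ↦ W.not_hasSurjectiveModNGaloisRep_of_hasCM hCM hprime hp2 hs
  have hbig : ∀ u : Module.End ℤ_[p] (W.tateModule p), IsUnit u → u ∈ Set.range (W.galoisRepTate p) :=
    fun u hu ↦ ThreeAdicImageOverK.mem_range_galoisRepTate_of_forall_hasSurjectiveModNGaloisRep W p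
      (serre_hasSurjectiveModNGaloisRep_pow_holds W p hp hs) u hu
  -- total non-splitting above `p` (from `p ∤ h_K`) and a local generator matching `γ₂`
  have h𝔭 : AcSigned.IsNonsplitIn κ₂ v :=
    SignedBaseChangeAcDivAnticyclotomicNonsplit.isNonsplitIn_of_isAnticyclotomic_of_not_dvd_classNumber
      hK hp2 κ₂ hκ₂ hh hv
  obtain ⟨γ𝔭, hγ𝔭⟩ : ∃ γ𝔭 : absoluteGaloisGroup (v.adicCompletion K),
      κ₂ (resGalOfEmb (closureEmb (K := K) (v.adicCompletion K)) γ𝔭) = κ₂ γ₂ := h𝔭 (κ₂ γ₂)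
  -- Castella–Wan's frame and the inputs of the proof of Thm. 6.8 at the sign `+`
  obtain ⟨ΩK₁, Ωp₁, LW, hΩK₁, hLW, hε⟩ :=
    hCW N W K p κ₂ v vbar hS ι hf hN' hHg hp3 hι γ₂ hγF.out h𝔭 γ𝔭 hγ𝔭
  obtain ⟨z, hT⟩ := hε 1
  -- `E(K_{∞,w})[p^∞] = 0` at both primes above `p`
  have hNT : ∀ w : HeightOneSpectrum (𝓞 K), ((p : ℕ) : 𝓞 K) ∈ w.asIdeal →
      FixedPoints.addSubgroup ↥(GreenbergSelmer.decomp w ⊓ κ₂.kerSubgroup)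
        ((W.baseChange K).geomPrimaryTorsion p) = ⊥ := by
    intro w hw
    rcases GreenbergFullAtSelmer.eq_or_eq_of_natCast_mem_of_ne hK.1 hv hvbar hvv hw with rfl | rfl
    · exact UniversalToricDescentSignedSetting.fixedPoints_decomp_inf_kerSubgroup_geomPrimaryTorsion_eq_bot_of_setting
        W K p κ₂ _ vbar hS
    · exact UniversalToricDescentSignedSetting.fixedPoints_decomp_inf_kerSubgroup_geomPrimaryTorsion_eq_bot_of_setting
        W K p κ₂ _ v hS'
  -- `rank X_+ = 1`: Longo–Vigni on Kobayashi's dual, transported by the identity of the two signed Selmer groups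
  have heq := SignedBaseChangeAcDivXAcTorsionCarrier.selmer_sgn_eq_signedSelmerInfty (W.baseChange K) κ₂
    hp2 1 hNT
  have hD := hLV W K p κ₂ v vbar hS N hN' h3N hHg hp hCM hbig γ₂ hγF.out 1
    (signedSelmerDualData (W.baseChange K) κ₂ 1 hγF.out)
  have hX : X.HasRank (W.baseChange K) p κ₂ ∅ (fun _ ↦ .sgn 1) hγF.out 1 :=
    SignedBaseChangeAcDivXAcTorsionCarrier.X.hasRank_sgn_of_signedSelmerDual (W.baseChange K) p κ₂
      hγF.out 1 heq hD
  -- `finrank Sel_+(K, 𝐓^ac) = 1` (Lemma 6.7 (1)), hence `loc_v` is injective on `Sel_+`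
  have hfin := SignedBaseChangeAcDivTransferSideInjective.finrank_selmerLambdaAdic_sgn_eq_one_of_lemma67
    (hL67 N W K p κ₂ v vbar) hS hN' hHg hp3 hγF.out 1 hX
  have hinj := SignedBaseChangeAcDivTransferSideInjective.TransferInputs.locSignedAt_injective_of_finrank_eq_one
    hT hfin
  -- print's `Sel_+(K, 𝐓^ac) = Sel_{+,rel}(K, 𝐓^ac)` (MS p. 30)
  have hle := hRel N W K p κ₂ v vbar hS ι hf hN' hHg hp3 hι γ₂ hγF.out 1 hfin hX
  have hEq : ∀ x' : selmerLambdaAdic (W.baseChange K) p κ₂ γ₂ (PCond.at vbar .rel (.sgn 1)),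
      ∃ x : selmerLambdaAdic (W.baseChange K) p κ₂ γ₂ (fun _ ↦ .sgn 1),
        locSignedAt (W.baseChange K) p κ₂ v h𝔭 γ₂ γ𝔭 hγ𝔭 (fun _ ↦ .sgn 1) 1 rfl hS.mem x =
          locSignedAt (W.baseChange K) p κ₂ v h𝔭 γ₂ γ𝔭 hγ𝔭 (PCond.at vbar .rel (.sgn 1)) 1
            (PCond.at_of_ne .rel (.sgn 1) (fun h ↦ hS.ne h.symm)) hS.mem x' :=
    fun x' ↦ ⟨⟨x'.1, hle x'.2⟩, Subtype.ext rfl⟩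
  -- the Eisenstein input at `(z⁺, L_W)`
  obtain ⟨k, hEis⟩ := hKoly hIn hmodP W p hp hgood ha0 hs K ι v vbar κ₁ κ₂ γ₁ γ₂ N f hf hN hK hh hsplit hv
    hvbar hvv hι hcop hHeeg hodd hne3 hκ₁ hκ₂ h𝔭 γ𝔭 hγ𝔭 (fun h ↦ hS.ne h.symm) hS.mem ΩK₁ Ωp₁ LW z hΩK₁ hLW hT
  -- helper A: `p^k · Ch_Λ(X_ac) · R₀⟦T⟧ ⊆ (L_W)` along `ℤ_p → R₀`
  have hA := SignedBaseChangeAcDivEisensteinTransfer.TransferInputs.span_pow_mul_XAc_charIdeal_map_le_span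
    hT hvbar hinj hX hEq hEis (Halves.toUnr p) (Halves.coe_toUnr (p := p))
  -- helper B: the two frames generate the same ideal along `J₀`
  have hpN : ¬ p ∣ N := by
    intro hpN
    rw [← hN'] at hpN
    exact not_dvd_conductorNorm_of_hasGoodReductionAtPrime W hgood hpN
  have hpD : ¬ (p : ℤ) ∣ NumberField.discr K :=
    not_dvd_discr_of_ncard_primesOver hprime (hsplit.trans hK.1.symm)
  have hconc := SignedBaseChangeAcDivFrameConcordance.span_map_eq_of_isCWBDPLFunction_of_isBDPLFunction_of_coe_eq
    hp2 hK hκ₂ hγF.out hpN hpD hΩK₁ hΩK (coe_units_unrIntegers_ne_zero Ωp₁) (coe_units_unrIntegers_ne_zero Ωp')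
    hLW hL J₀ hJ₀
  -- `J = J₀ ∘ (ℤ_p → R₀)`
  have hJfac : J = J₀.comp (Halves.toUnr p) := by
    refine RingHom.ext fun x ↦ Subtype.ext ?_
    rw [hJ x, RingHom.comp_apply, hJ₀, Halves.coe_toUnr]
    rfl
  -- push helper A forward along `J₀`
  have hmap := Ideal.map_mono (f := PowerSeries.map J₀) hA
  rw [Ideal.map_mul, Ideal.map_span, Set.image_singleton, map_pow, map_natCast, Ideal.map_map,
    ← PowerSeries.map_comp, ← hJfac, Ideal.map_span, Set.image_singleton, hconc] at hmap
  refine ⟨k, fun y hy ↦ ?_⟩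
  have hy' : ((p : ℕ) : PowerSeries (PadicComplexInt p)) ^ k * y ∈
      Ideal.span {((p : ℕ) : PowerSeries (PadicComplexInt p)) ^ k} *
        (Castella2018.AcSelmer.XAc.charIdeal (W.baseChange K) p κ₂ vbar ∅ γ₂).map (PowerSeries.map J) :=
    Ideal.mul_mem_mul (Ideal.mem_span_singleton_self _) hy
  rw [map_pow, map_natCast]
  exact hmap hy'

end Summit.BirchSwinnertonDyer.BirchSwinnertonDyer.Theorems.SignedBaseChangeAcDivS1OfSignedEisenstein

end
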